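import Mathlib.Analysis.ODE.ExistUnique
import Mathlib.Analysis.Calculus.Deriv.Prod
import Mathlib.Analysis.Calculus.Deriv.Mul
import Mathlib.Analysis.Calculus.Deriv.Comp
import Literature.Analysis.ODE.LinearGrowth
import HarnessLib

/-!
# Global solutions of the one-dimensional Schrödinger equation `u'' = q u`

Topic `Literature/Analysis/ODE` (namespace `Literature.Analysis.ODE`). The linear second-order scalar
equation `u'' = q(s) u` on the whole line, `q : ℝ → ℝ` continuous (the one-dimensional Schrödinger /
Sturm–Liouville equation in Liouville normal form; Hartman, *Ordinary Differential Equations*,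
Ch. XI §1–§2), treated classically: a solution is a differentiable `u : ℝ → ℝ` whose derivative
`deriv u` has derivative `q s · u s` at every `s` (`IsSchrodingerSol q u`). Everything is proved.

* `schrodingerField q` — the phase-plane field `(y₁, y₂) ↦ (y₂, q(t) y₁)` on `ℝ × ℝ` and its
  Lipschitz / growth constant `max 1 |q t|` (`exists_const_schrodingerField` on compact intervals).
* `IsSchrodingerSol` and its algebra (`const_mul`, `add`, `neg`, `sub`, `comp_neg`), the phase
  curve `s ↦ (u s, u' s)` as an integral curve of `schrodingerField q` (`hasDerivAt_phase`).
* `exists_isSchrodingerSol` — for continuous `q` and every `s₀, c₀, c₁` there is a global solution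
  with `u s₀ = c₀`, `u' s₀ = c₁` (`Literature.Analysis.ODE.exists_solution_of_linearGrowth_at`;
  Hartman Ch. IV, Lemma 1.1).
* `IsSchrodingerSol.eq_of_eq` (uniqueness for the initial value problem, Mathlib's
  `ODE_solution_unique_of_mem_Ioo`), `eq_zero_of_eq_zero` (a double zero forces `u ≡ 0`, Hartman
  Ch. IV, Cor. 1.1), `deriv_ne_zero_of_eq_zero` (zeros of a nontrivial solution are simple).
* `IsSchrodingerSol.dist_phase_le` (`_right`, `_left`, `_exp`) — continuous dependence on the
  coefficient and the data (Hartman Ch. V, Thm. 2.1, in the quantitative Grönwall form): for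
  solutions `u` of `u'' = q₁u` and `v` of `v'' = q₂v` on `[a, b] ∋ s₀` with `|q₁| ≤ K` (`K ≥ 1`),
  `|q₁ - q₂| ≤ η`, `|v| ≤ P` there,
  `dist (u t, u' t) (v t, v' t) ≤ gronwallBound (dist (u s₀, u' s₀) (v s₀, v' s₀)) K (η P) |t - s₀|`
  `≤ (dist … + η P) e^{K|t - s₀|}` (Mathlib's `dist_le_of_approx_trajectories_ODE_of_mem`, forward
  and, by reflection `s ↦ -s`, backward in time; `gronwallBound_le_of_one_le`).

## References

* P. Hartman, *Ordinary Differential Equations*, Classics in Applied Mathematics 38 (SIAM 2002),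
  Ch. IV §1 (Lemma 1.1, Cor. 1.1, Thm. 1.1), Ch. V Thm. 2.1, Ch. XI §1–§2. Key `Hartman2002`.
-/

noncomputable section

open Set Metric Filter
open scoped NNReal Topology

namespace Literature.Analysis.ODE

/-! ## The equation `u'' = q u`: phase field, solutions, existence -/

/-- The phase-plane vector field of `u'' = q(t) u`: `(y₁, y₂) ↦ (y₂, q t · y₁)` on `ℝ × ℝ`
(Hartman, Ch. XI §1–§2). [folklore] -/
def schrodingerField (q : ℝ → ℝ) (t : ℝ) (y : ℝ × ℝ) : ℝ × ℝ := (y.2, q t * y.1)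

/-- `schrodingerField q t` is linear, with `‖F t y - F t z‖ ≤ max 1 |q t| · ‖y - z‖`. [folklore] -/
theorem norm_schrodingerField_sub_le (q : ℝ → ℝ) (t : ℝ) (y z : ℝ × ℝ) :
    ‖schrodingerField q t y - schrodingerField q t z‖ ≤ max 1 |q t| * ‖y - z‖ := by
  simp only [schrodingerField, Prod.mk_sub_mk, Prod.norm_mk, Real.norm_eq_abs, ← mul_sub]
  have hy : ‖y - z‖ = max |y.1 - z.1| |y.2 - z.2| := by
    rw [Prod.norm_def, Prod.fst_sub, Prod.snd_sub, Real.norm_eq_abs, Real.norm_eq_abs]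
  rw [hy, abs_mul]
  refine max_le ?_ ?_
  · calc |y.2 - z.2| ≤ 1 * max |y.1 - z.1| |y.2 - z.2| := by rw [one_mul]; exact le_max_right _ _
      _ ≤ max 1 |q t| * max |y.1 - z.1| |y.2 - z.2| := by gcongr; exact le_max_left _ _
  · gcongr
    · exact le_max_right _ _
    · exact le_max_left _ _

/-- Linear growth: `‖schrodingerField q t y‖ ≤ max 1 |q t| · ‖y‖`. [folklore] -/
theorem norm_schrodingerField_le (q : ℝ → ℝ) (t : ℝ) (y : ℝ × ℝ) :
    ‖schrodingerField q t y‖ ≤ max 1 |q t| * ‖y‖ := by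
  have h := norm_schrodingerField_sub_le q t y 0
  simpa [schrodingerField] using h

/-- `schrodingerField q t` is `max 1 |q t|`-Lipschitz. [folklore] -/
theorem lipschitzWith_schrodingerField (q : ℝ → ℝ) (t : ℝ) :
    LipschitzWith ⟨max 1 |q t|, le_trans zero_le_one (le_max_left _ _)⟩ (schrodingerField q t) :=
  LipschitzWith.of_dist_le_mul fun y z => by
    rw [dist_eq_norm, dist_eq_norm]
    exact norm_schrodingerField_sub_le q t y z

/-- On every compact time interval a continuous coefficient gives one Lipschitz/growth constant
`K = max 1 (sup |q|)` for the phase field. [folklore] -/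
theorem exists_const_schrodingerField {q : ℝ → ℝ} (hq : Continuous q) (a b : ℝ) :
    ∃ K : ℝ≥0, 1 ≤ (K : ℝ) ∧ (∀ t ∈ Icc a b, |q t| ≤ K) ∧
      ∀ t ∈ Icc a b, LipschitzWith K (schrodingerField q t) ∧
        ∀ y, ‖schrodingerField q t y‖ ≤ K * ‖y‖ := by
  obtain ⟨C, hC⟩ := isCompact_Icc.exists_bound_of_continuousOn (hq.continuousOn (s := Icc a b))
  refine ⟨⟨max 1 C, le_trans zero_le_one (le_max_left _ _)⟩, le_max_left _ _, fun t ht => ?_,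
    fun t ht => ⟨?_, fun y => ?_⟩⟩
  · exact (Real.norm_eq_abs _ ▸ hC t ht).trans (le_max_right _ _)
  · refine (lipschitzWith_schrodingerField q t).weaken ?_
    change max 1 |q t| ≤ max 1 C
    exact max_le_max le_rfl (Real.norm_eq_abs _ ▸ hC t ht)
  · refine (norm_schrodingerField_le q t y).trans ?_
    gcongr
    change max 1 |q t| ≤ max 1 C
    exact max_le_max le_rfl (Real.norm_eq_abs _ ▸ hC t ht)

/-- **Classical global solutions of `u'' = q u`.** `u : ℝ → ℝ` is differentiable on `ℝ` and its
derivative `deriv u` has derivative `q s · u s` at every `s` (a `C²` solution when `q` is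
continuous; Hartman, Ch. XI §1, eq. (1.1) with `p ≡ 1`). [folklore] -/
structure IsSchrodingerSol (q u : ℝ → ℝ) : Prop where
  differentiable : Differentiable ℝ u
  hasDerivAt_deriv : ∀ s, HasDerivAt (deriv u) (q s * u s) s

namespace IsSchrodingerSol

variable {q u v : ℝ → ℝ}

/-- The first derivative. [folklore] -/
theorem hasDerivAt (hu : IsSchrodingerSol q u) (s : ℝ) : HasDerivAt u (deriv u s) s :=
  (hu.differentiable s).hasDerivAt

/-- Solutions are continuous. [folklore] -/
theorem continuous (hu : IsSchrodingerSol q u) : Continuous u := hu.differentiable.continuous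

/-- The derivative of a solution is differentiable. [folklore] -/
theorem differentiable_deriv (hu : IsSchrodingerSol q u) : Differentiable ℝ (deriv u) :=
  fun s => (hu.hasDerivAt_deriv s).differentiableAt

/-- The derivative of a solution is continuous. [folklore] -/
theorem continuous_deriv (hu : IsSchrodingerSol q u) : Continuous (deriv u) :=
  hu.differentiable_deriv.continuous

/-- The equation: `u'' = q u`. [folklore] -/
theorem deriv_deriv (hu : IsSchrodingerSol q u) (s : ℝ) : deriv (deriv u) s = q s * u s :=
  (hu.hasDerivAt_deriv s).deriv

/-- Constant multiples of solutions are solutions. [folklore] -/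
theorem const_mul (hu : IsSchrodingerSol q u) (c : ℝ) : IsSchrodingerSol q (fun s => c * u s) := by
  have hd : deriv (fun s => c * u s) = fun s => c * deriv u s := by
    funext s
    exact ((hu.hasDerivAt s).const_mul c).deriv
  refine ⟨fun s => ((hu.hasDerivAt s).const_mul c).differentiableAt, fun s => ?_⟩
  rw [hd]
  simpa [mul_left_comm] using (hu.hasDerivAt_deriv s).const_mul c

/-- Sums of solutions are solutions. [folklore] -/
theorem add (hu : IsSchrodingerSol q u) (hv : IsSchrodingerSol q v) :
    IsSchrodingerSol q (fun s => u s + v s) := by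
  have hd : deriv (fun s => u s + v s) = fun s => deriv u s + deriv v s := by
    funext s
    exact ((hu.hasDerivAt s).add (hv.hasDerivAt s)).deriv
  refine ⟨fun s => ((hu.hasDerivAt s).add (hv.hasDerivAt s)).differentiableAt, fun s => ?_⟩
  rw [hd, mul_add]
  exact (hu.hasDerivAt_deriv s).add (hv.hasDerivAt_deriv s)

/-- Negatives of solutions are solutions. [folklore] -/
theorem neg (hu : IsSchrodingerSol q u) : IsSchrodingerSol q (fun s => -u s) := by
  simpa using hu.const_mul (-1)

/-- Differences of solutions are solutions. [folklore] -/
theorem sub (hu : IsSchrodingerSol q u) (hv : IsSchrodingerSol q v) :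
    IsSchrodingerSol q (fun s => u s - v s) := by
  simpa [sub_eq_add_neg] using hu.add hv.neg

/-- **Time reversal**: `s ↦ u (-s)` solves the equation with coefficient `s ↦ q (-s)`. [folklore] -/
theorem comp_neg (hu : IsSchrodingerSol q u) :
    IsSchrodingerSol (fun s => q (-s)) (fun s => u (-s)) := by
  have h1 : ∀ s, HasDerivAt (fun s => u (-s)) (-deriv u (-s)) s := fun s => by
    have h := HasDerivAt.scomp s (hu.hasDerivAt (-s)) (hasDerivAt_neg s)
    simp only [Function.comp_def, neg_smul, one_smul] at h
    exact h
  have hd : deriv (fun s => u (-s)) = fun s => -deriv u (-s) := funext fun s => (h1 s).deriv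
  refine ⟨fun s => (h1 s).differentiableAt, fun s => ?_⟩
  rw [hd]
  have h2 : HasDerivAt (fun s => deriv u (-s)) (-(q (-s) * u (-s))) s := by
    have h := HasDerivAt.scomp s (hu.hasDerivAt_deriv (-s)) (hasDerivAt_neg s)
    simp only [Function.comp_def, neg_smul, one_smul] at h
    exact h
  have h3 := h2.neg
  rw [neg_neg] at h3
  exact h3

/-- The derivative of the reversed solution. [folklore] -/
theorem deriv_comp_neg (hu : IsSchrodingerSol q u) (s : ℝ) :
    deriv (fun s => u (-s)) s = -deriv u (-s) := by
  have h1 : HasDerivAt (fun s => u (-s)) (-deriv u (-s)) s := by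
    have h := HasDerivAt.scomp s (hu.hasDerivAt (-s)) (hasDerivAt_neg s)
    simp only [Function.comp_def, neg_smul, one_smul] at h
    exact h
  exact h1.deriv

/-- The phase curve `s ↦ (u s, u' s)` is an integral curve of `schrodingerField q`. [folklore] -/
theorem hasDerivAt_phase (hu : IsSchrodingerSol q u) (s : ℝ) :
    HasDerivAt (fun s => (u s, deriv u s)) (schrodingerField q s (u s, deriv u s)) s :=
  (hu.hasDerivAt s).prodMk (hu.hasDerivAt_deriv s)

end IsSchrodingerSol

/-- **Global existence for `u'' = q u`** (`q` continuous): for every initial time `s₀` and data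
`(c₀, c₁)` there is a global classical solution with `u s₀ = c₀`, `u' s₀ = c₁` ("the initial value
problem [...] has a unique solution `y = y(t)` and `y(t)` exists on `a ≤ t ≤ b`", for every `[a, b]`).
[cite: Hartman2002, Ch. IV Lemma 1.1] -/
theorem exists_isSchrodingerSol {q : ℝ → ℝ} (hq : Continuous q) (s₀ c₀ c₁ : ℝ) :
    ∃ u : ℝ → ℝ, IsSchrodingerSol q u ∧ u s₀ = c₀ ∧ deriv u s₀ = c₁ := by
  obtain ⟨α, hα0, hα⟩ := exists_solution_of_linearGrowth_at (v := schrodingerField q)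
    (fun T => by
      obtain ⟨K, -, -, hK⟩ := exists_const_schrodingerField hq (-T) T
      exact ⟨K, hK⟩)
    (fun y => by unfold schrodingerField; fun_prop) s₀ (c₀, c₁)
  have h1 : ∀ t, HasDerivAt (fun t => (α t).1) (α t).2 t := fun t => by
    simpa [schrodingerField] using (hα t).hasFDerivAt.fst.hasDerivAt
  have hd : deriv (fun t => (α t).1) = fun t => (α t).2 := funext fun t => (h1 t).deriv
  refine ⟨fun t => (α t).1, ⟨fun t => (h1 t).differentiableAt, fun t => ?_⟩, by simp [hα0], ?_⟩
  · rw [hd]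
    simpa [schrodingerField] using (hα t).hasFDerivAt.snd.hasDerivAt
  · rw [hd]
    simp [hα0]

/-! ## Uniqueness and continuous dependence -/

namespace IsSchrodingerSol

variable {q q₁ q₂ u v : ℝ → ℝ}

/-- **Uniqueness for the initial value problem** (`q` continuous): two solutions of `u'' = q u`
with the same value and derivative at one time coincide (Mathlib's `ODE_solution_unique_of_mem_Ioo`
applied to the phase curves on every bounded time interval). [cite: Hartman2002, Ch. IV Lemma 1.1] -/
theorem eq_of_eq (hq : Continuous q) (hu : IsSchrodingerSol q u) (hv : IsSchrodingerSol q v)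
    {s₀ : ℝ} (h0 : u s₀ = v s₀) (h1 : deriv u s₀ = deriv v s₀) : u = v := by
  funext t
  set A : ℝ := max |s₀| |t| + 1 with hA
  have hs₀ : s₀ ∈ Ioo (-A) A := by
    constructor <;> [have := neg_abs_le s₀; have := le_abs_self s₀] <;>
      linarith [le_max_left |s₀| |t|]
  have ht : t ∈ Ioo (-A) A := by
    constructor <;> [have := neg_abs_le t; have := le_abs_self t] <;>
      linarith [le_max_right |s₀| |t|]
  obtain ⟨K, -, -, hK⟩ := exists_const_schrodingerField hq (-A) A
  have key := ODE_solution_unique_of_mem_Ioo (v := schrodingerField q) (s := fun _ => univ) (K := K)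
    (f := fun s => (u s, deriv u s)) (g := fun s => (v s, deriv v s))
    (fun τ hτ => ((hK τ (Ioo_subset_Icc_self hτ)).1).lipschitzOnWith) hs₀
    (fun τ _ => ⟨hu.hasDerivAt_phase τ, mem_univ _⟩)
    (fun τ _ => ⟨hv.hasDerivAt_phase τ, mem_univ _⟩) (by simp [h0, h1]) ht
  exact congrArg Prod.fst key

/-- A solution with a double zero vanishes identically ("If `y = y(t)` is a solution of (1.1) and
`y(t₀) = 0` for some `t₀` [...] then `y(t) ≡ 0`", for the phase vector `(u, u')`).
[cite: Hartman2002, Ch. IV Cor. 1.1] -/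
theorem eq_zero_of_eq_zero (hq : Continuous q) (hu : IsSchrodingerSol q u) {s₀ : ℝ}
    (h0 : u s₀ = 0) (h1 : deriv u s₀ = 0) : u = 0 := by
  have hz : IsSchrodingerSol q (0 : ℝ → ℝ) := by
    refine ⟨differentiable_const 0, fun s => ?_⟩
    rw [show deriv (0 : ℝ → ℝ) = 0 from deriv_const' 0]
    rw [Pi.zero_apply, mul_zero]
    exact hasDerivAt_const s (0 : ℝ)
  exact hu.eq_of_eq hq hz (by simpa using h0) (by simpa using h1)

/-- A solution which is not identically zero has only simple zeros: `u s = 0 → u' s ≠ 0`.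
[folklore] -/
theorem deriv_ne_zero_of_eq_zero (hq : Continuous q) (hu : IsSchrodingerSol q u) {s₁ : ℝ}
    (hne : u s₁ ≠ 0) {s : ℝ} (hs : u s = 0) : deriv u s ≠ 0 := fun h =>
  hne (by rw [hu.eq_zero_of_eq_zero hq hs h]; rfl)

/-- Distances of phase points are unchanged by reversing the sign of the velocities. [folklore] -/
theorem dist_mk_neg_mk_neg (a b c d : ℝ) : dist (a, -b) (c, -d) = dist (a, b) (c, d) := by
  simp [Prod.dist_eq, dist_neg_neg]

/-- **Continuous dependence, forward in time.** Let `u'' = q₁ u`, `v'' = q₂ v`, and on `[s₀, b]`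
let `|q₁| ≤ K` (`K ≥ 1`), `|q₁ - q₂| ≤ η`, `|v| ≤ P`. Then for `t ∈ [s₀, b]` the phase points satisfy
`dist (u t, u' t) (v t, v' t) ≤ gronwallBound (dist (u s₀, u' s₀) (v s₀, v' s₀)) K (η P) (t - s₀)`
(`v` is an `η P`-approximate solution of the first equation; Mathlib's
`dist_le_of_approx_trajectories_ODE_of_mem`; the quantitative form of the continuity of the general
solution in data and parameters, Hartman Ch. V, Thm. 2.1). [cite: Hartman2002, Ch. V Thm. 2.1] -/
theorem dist_phase_le_right (hu : IsSchrodingerSol q₁ u) (hv : IsSchrodingerSol q₂ v) {s₀ b : ℝ}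
    {K η P : ℝ} (hK : ∀ t ∈ Icc s₀ b, |q₁ t| ≤ K) (hK1 : 1 ≤ K)
    (hη : ∀ t ∈ Icc s₀ b, |q₁ t - q₂ t| ≤ η) (hP : ∀ t ∈ Icc s₀ b, |v t| ≤ P) (hη0 : 0 ≤ η) :
    ∀ t ∈ Icc s₀ b, dist (u t, deriv u t) (v t, deriv v t) ≤
      gronwallBound (dist (u s₀, deriv u s₀) (v s₀, deriv v s₀)) K (η * P) (t - s₀) := by
  intro t ht
  lift K to ℝ≥0 using zero_le_one.trans hK1 with K' hK'
  have key := dist_le_of_approx_trajectories_ODE_of_mem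
    (v := schrodingerField q₁) (s := fun _ => univ) (K := K')
    (f := fun s => (u s, deriv u s)) (g := fun s => (v s, deriv v s))
    (f' := fun s => schrodingerField q₁ s (u s, deriv u s))
    (g' := fun s => schrodingerField q₂ s (v s, deriv v s))
    (a := s₀) (b := b) (εf := 0) (εg := η * P) (δ := dist (u s₀, deriv u s₀) (v s₀, deriv v s₀))
    (fun τ hτ => ((lipschitzWith_schrodingerField q₁ τ).weaken (by
        change max 1 |q₁ τ| ≤ (K' : ℝ)
        exact max_le hK1 (hK τ (Ico_subset_Icc_self hτ)))).lipschitzOnWith)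
    (fun τ _ => (hu.hasDerivAt_phase τ).continuousAt.continuousWithinAt)
    (fun τ _ => (hu.hasDerivAt_phase τ).hasDerivWithinAt)
    (fun τ _ => by simp)
    (fun τ _ => mem_univ _)
    (fun τ _ => (hv.hasDerivAt_phase τ).continuousAt.continuousWithinAt)
    (fun τ _ => (hv.hasDerivAt_phase τ).hasDerivWithinAt)
    (fun τ hτ => by
      have h1 : dist (schrodingerField q₂ τ (v τ, deriv v τ)) (schrodingerField q₁ τ (v τ, deriv v τ)) =
          |q₁ τ - q₂ τ| * |v τ| := by
        simp only [schrodingerField, Prod.dist_eq, dist_self, Real.dist_eq, ← sub_mul, abs_mul]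
        rw [max_eq_right (by positivity), abs_sub_comm]
      rw [h1]
      exact mul_le_mul (hη τ (Ico_subset_Icc_self hτ)) (hP τ (Ico_subset_Icc_self hτ))
        (abs_nonneg _) hη0)
    (fun τ _ => mem_univ _)
    le_rfl t ht
  rwa [zero_add] at key

/-- **Continuous dependence, backward in time**: the estimate of `dist_phase_le_right` on
`[a, s₀]` with `s₀ - t` in place of `t - s₀` (time reversal `s ↦ -s`). [folklore] -/
theorem dist_phase_le_left (hu : IsSchrodingerSol q₁ u) (hv : IsSchrodingerSol q₂ v) {a s₀ : ℝ}
    {K η P : ℝ} (hK : ∀ t ∈ Icc a s₀, |q₁ t| ≤ K) (hK1 : 1 ≤ K)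
    (hη : ∀ t ∈ Icc a s₀, |q₁ t - q₂ t| ≤ η) (hP : ∀ t ∈ Icc a s₀, |v t| ≤ P) (hη0 : 0 ≤ η) :
    ∀ t ∈ Icc a s₀, dist (u t, deriv u t) (v t, deriv v t) ≤
      gronwallBound (dist (u s₀, deriv u s₀) (v s₀, deriv v s₀)) K (η * P) (s₀ - t) := by
  intro t ht
  have h := dist_phase_le_right hu.comp_neg hv.comp_neg (s₀ := -s₀) (b := -a) (K := K) (η := η)
    (P := P) (fun τ hτ => hK (-τ) ⟨by linarith [hτ.2], by linarith [hτ.1]⟩) hK1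
    (fun τ hτ => hη (-τ) ⟨by linarith [hτ.2], by linarith [hτ.1]⟩)
    (fun τ hτ => hP (-τ) ⟨by linarith [hτ.2], by linarith [hτ.1]⟩) hη0 (-t)
    ⟨by linarith [ht.2], by linarith [ht.1]⟩
  simp only [hu.deriv_comp_neg, hv.deriv_comp_neg, neg_neg, dist_mk_neg_mk_neg] at h
  rwa [show -t - -s₀ = s₀ - t by ring] at h

/-- **Continuous dependence on coefficient and data** on `[a, b] ∋ s₀`, both directions of time:
`dist (u t, u' t) (v t, v' t) ≤ gronwallBound (dist of the data at s₀) K (η P) |t - s₀|`.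
[cite: Hartman2002, Ch. V Thm. 2.1] -/
theorem dist_phase_le (hu : IsSchrodingerSol q₁ u) (hv : IsSchrodingerSol q₂ v) {a b s₀ : ℝ}
    (hs₀ : s₀ ∈ Icc a b) {K η P : ℝ} (hK : ∀ t ∈ Icc a b, |q₁ t| ≤ K) (hK1 : 1 ≤ K)
    (hη : ∀ t ∈ Icc a b, |q₁ t - q₂ t| ≤ η) (hP : ∀ t ∈ Icc a b, |v t| ≤ P) (hη0 : 0 ≤ η) :
    ∀ t ∈ Icc a b, dist (u t, deriv u t) (v t, deriv v t) ≤
      gronwallBound (dist (u s₀, deriv u s₀) (v s₀, deriv v s₀)) K (η * P) |t - s₀| := by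
  intro t ht
  rcases le_total s₀ t with hst | hts
  · rw [abs_of_nonneg (sub_nonneg.2 hst)]
    have hsub : Icc s₀ b ⊆ Icc a b := Icc_subset_Icc hs₀.1 le_rfl
    exact dist_phase_le_right hu hv (fun τ hτ => hK τ (hsub hτ)) hK1 (fun τ hτ => hη τ (hsub hτ))
      (fun τ hτ => hP τ (hsub hτ)) hη0 t ⟨hst, ht.2⟩
  · rw [abs_of_nonpos (sub_nonpos.2 hts), neg_sub]
    have hsub : Icc a s₀ ⊆ Icc a b := Icc_subset_Icc le_rfl hs₀.2
    exact dist_phase_le_left hu hv (fun τ hτ => hK τ (hsub hτ)) hK1 (fun τ hτ => hη τ (hsub hτ))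
      (fun τ hτ => hP τ (hsub hτ)) hη0 t ⟨ht.1, hts⟩

end IsSchrodingerSol

/-- Elementary simplification of the Grönwall bound: for `K ≥ 1`, `ε ≥ 0`,
`gronwallBound δ K ε x ≤ (δ + ε) e^{K x}`. [folklore] -/
theorem gronwallBound_le_of_one_le {δ K ε x : ℝ} (hK : 1 ≤ K) (hε : 0 ≤ ε) :
    gronwallBound δ K ε x ≤ (δ + ε) * Real.exp (K * x) := by
  have hK0 : K ≠ 0 := by positivity
  rw [gronwallBound_of_K_ne_0 hK0]
  have h1 : 0 ≤ Real.exp (K * x) := (Real.exp_pos _).le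
  have h2 : ε / K ≤ ε := div_le_self hε hK
  have h3 : ε / K * (Real.exp (K * x) - 1) ≤ ε * Real.exp (K * x) := by
    have : 0 ≤ ε / K := by positivity
    nlinarith
  show δ * Real.exp (K * x) + ε / K * (Real.exp (K * x) - 1) ≤ (δ + ε) * Real.exp (K * x)
  linarith

namespace IsSchrodingerSol

variable {q₁ q₂ u v : ℝ → ℝ}

/-- Continuous dependence in closed form: on `[a, b] ∋ s₀`,
`dist (u t, u' t) (v t, v' t) ≤ (dist of the data at s₀ + η P) · exp (K |t - s₀|)`. [folklore] -/
theorem dist_phase_le_exp (hu : IsSchrodingerSol q₁ u) (hv : IsSchrodingerSol q₂ v) {a b s₀ : ℝ}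
    (hs₀ : s₀ ∈ Icc a b) {K η P : ℝ} (hK : ∀ t ∈ Icc a b, |q₁ t| ≤ K) (hK1 : 1 ≤ K)
    (hη : ∀ t ∈ Icc a b, |q₁ t - q₂ t| ≤ η) (hP : ∀ t ∈ Icc a b, |v t| ≤ P) (hη0 : 0 ≤ η)
    (hP0 : 0 ≤ P) :
    ∀ t ∈ Icc a b, dist (u t, deriv u t) (v t, deriv v t) ≤
      (dist (u s₀, deriv u s₀) (v s₀, deriv v s₀) + η * P) * Real.exp (K * |t - s₀|) :=
  fun t ht => (hu.dist_phase_le hv hs₀ hK hK1 hη hP hη0 t ht).trans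
    (gronwallBound_le_of_one_le hK1 (by positivity))

/-- The position component of the phase distance. [folklore] -/
theorem abs_sub_le_dist_phase (u v : ℝ → ℝ) (t : ℝ) :
    |u t - v t| ≤ dist (u t, deriv u t) (v t, deriv v t) := by
  rw [Prod.dist_eq, Real.dist_eq]
  exact le_max_left _ _

/-- The velocity component of the phase distance. [folklore] -/
theorem abs_deriv_sub_le_dist_phase (u v : ℝ → ℝ) (t : ℝ) :
    |deriv u t - deriv v t| ≤ dist (u t, deriv u t) (v t, deriv v t) := by
  rw [Prod.dist_eq, Real.dist_eq, Real.dist_eq]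
  exact le_max_right _ _

end IsSchrodingerSol

end Literature.Analysis.ODE
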